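import Summits.Ventures.PercRepro2.CaseOneA2EdgeT
import Summits.Ventures.PercRepro2.CaseOneA2EdgeIB

/-!
# The `(i)`-side forms along an `a₂a₃`-edge with the T-world form, and THE SIX FORMS
(blind cell PercRepro2, p1 g30; the mirror of `CaseOneA2EdgeT.lean`)

`Λᴵ(c, y) = −c₁ (y₁ R₃ − y₀ P₃) + c₀ (y₁ R₂ − y₀ P₁)` with `Bᴵ(y) = y₁ R₂ − y₀ P₁ ≥ 0` (BHK 1.3):
the form at the forced-open Q-pair is at least the sum of the forms at the PD pair and at the T-pair
(**`lamTI_c1_ge`**), the T-pair coefficient `Λᴵ(c_T⁰, y¹)` is `≥ 0` when `(i-T)` holds for `G − e₂`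
(**`lamTI_c0_y1_nonneg`**, `odds_t`), and with the identity **`iExprT_a2_edge`**:
**`zSplitIQ_of_a2_edge_T`** (`(i) ∧ (i-Q) ∧ (i-T)` of `G − e₂` ⟹ `(i-Q)(G)`) and
**`zSplitIT_of_a2_edge`** (`(i) ∧ (i-T)` of `G − e₂` ⟹ `(i-T)(G)`). Hence **`sixForms_of_a2_edge`**:
the six forms `(ii), (ii-Q), (ii-T), (i), (i-Q), (i-T)` transfer from `G − e₂` to `G` for every
`a₂a₃`-edge, with NO threshold hypothesis, and **`sixForms_of_a2Free`** (every `a₂a₃`-edge null at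
once). The T-world forms are exactly what closes the Q-threshold forms under the deletion of
`a₂`-edges at the statement vertex. Own code; standard axioms.
-/

namespace Summit.Ventures.PercRepro2

namespace CaseOne

section TIIdentity
variable {V : Type*} {E : Type*} [Fintype E] [DecidableEq E] {R : Type*} [CommRing R]
variable {ends : E → Sym2 V} {a₁ a₂ a₃ : V} {e₂ : E}

/-- **The T-threshold `(i)` along an `a₂a₃`-edge** (the mirror identity). -/
theorem iExprT_a2_edge (p : E → R) (he : ends e₂ = s(a₂, a₃)) (o b : V) :
    iExprT p ends o a₁ a₂ a₃ b (Dto p ends o a₁ a₂ a₃) (Dt p ends a₁ a₂ a₃) =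
      (1 - p e₂) *
        ((1 - p e₂) ^ 2 *
            iExprT (Function.update p e₂ 0) ends o a₁ a₂ a₃ b
              (Dto (Function.update p e₂ 0) ends o a₁ a₂ a₃)
              (Dt (Function.update p e₂ 0) ends a₁ a₂ a₃) +
          p e₂ * (1 - p e₂) *
            ((-(Dt (Function.update p e₂ 0) ends a₁ a₂ a₃ *
                (prob (Function.update p e₂ 1) (connEvent ends a₁ a₂)ᶜ *
                  prob (Function.update p e₂ 0) (connEvent ends a₁ b ∩ connEvent ends a₁ a₃ ∩
                    connEvent ends a₂ o ∩ (connEvent ends a₁ a₂)ᶜ) -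
                prob (Function.update p e₂ 1) (connEvent ends a₁ b ∩ (connEvent ends a₁ a₂)ᶜ) *
                  prob (Function.update p e₂ 0) (connEvent ends a₁ a₃ ∩ connEvent ends a₂ o ∩
                    (connEvent ends a₁ a₂)ᶜ))) +
              Dto (Function.update p e₂ 0) ends o a₁ a₂ a₃ *
                (prob (Function.update p e₂ 1) (connEvent ends a₁ a₂)ᶜ *
                  prob (Function.update p e₂ 0) (connEvent ends a₁ b ∩ connEvent ends a₁ a₃ ∩
                    (connEvent ends a₁ a₂)ᶜ) -
                prob (Function.update p e₂ 1) (connEvent ends a₁ b ∩ (connEvent ends a₁ a₂)ᶜ) *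
                  prob (Function.update p e₂ 0) (connEvent ends a₁ a₃ ∩ (connEvent ends a₁ a₂)ᶜ))) +
            (-(prob (Function.update p e₂ 1) (connEvent ends a₁ a₂)ᶜ *
                (prob (Function.update p e₂ 0) (connEvent ends a₁ a₂)ᶜ *
                  prob (Function.update p e₂ 0) (connEvent ends a₁ b ∩ connEvent ends a₁ a₃ ∩
                    connEvent ends a₂ o ∩ (connEvent ends a₁ a₂)ᶜ) -
                prob (Function.update p e₂ 0) (connEvent ends a₁ b ∩ (connEvent ends a₁ a₂)ᶜ) *
                  prob (Function.update p e₂ 0) (connEvent ends a₁ a₃ ∩ connEvent ends a₂ o ∩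
                    (connEvent ends a₁ a₂)ᶜ))) +
              Dqo (Function.update p e₂ 1) ends o a₁ a₂ *
                (prob (Function.update p e₂ 0) (connEvent ends a₁ a₂)ᶜ *
                  prob (Function.update p e₂ 0) (connEvent ends a₁ b ∩ connEvent ends a₁ a₃ ∩
                    (connEvent ends a₁ a₂)ᶜ) -
                prob (Function.update p e₂ 0) (connEvent ends a₁ b ∩ (connEvent ends a₁ a₂)ᶜ) *
                  prob (Function.update p e₂ 0) (connEvent ends a₁ a₃ ∩ (connEvent ends a₁ a₂)ᶜ)))) +
          p e₂ ^ 2 *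
            (-(prob (Function.update p e₂ 1) (connEvent ends a₁ a₂)ᶜ *
                (prob (Function.update p e₂ 1) (connEvent ends a₁ a₂)ᶜ *
                  prob (Function.update p e₂ 0) (connEvent ends a₁ b ∩ connEvent ends a₁ a₃ ∩
                    connEvent ends a₂ o ∩ (connEvent ends a₁ a₂)ᶜ) -
                prob (Function.update p e₂ 1) (connEvent ends a₁ b ∩ (connEvent ends a₁ a₂)ᶜ) *
                  prob (Function.update p e₂ 0) (connEvent ends a₁ a₃ ∩ connEvent ends a₂ o ∩
                    (connEvent ends a₁ a₂)ᶜ))) +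
              Dqo (Function.update p e₂ 1) ends o a₁ a₂ *
                (prob (Function.update p e₂ 1) (connEvent ends a₁ a₂)ᶜ *
                  prob (Function.update p e₂ 0) (connEvent ends a₁ b ∩ connEvent ends a₁ a₃ ∩
                    (connEvent ends a₁ a₂)ᶜ) -
                prob (Function.update p e₂ 1) (connEvent ends a₁ b ∩ (connEvent ends a₁ a₂)ᶜ) *
                  prob (Function.update p e₂ 0) (connEvent ends a₁ a₃ ∩ (connEvent ends a₁ a₂)ᶜ)))) := by
  rw [iExprT_eq, iExprT_eq, Dto_pin p e₂ o, Dt_pin p e₂, Dto_update_one p he o, Dt_update_one p he,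
    prob_a2_edge_of_subset_AQ p he (Y := connEvent ends a₁ b ∩ connEvent ends a₁ a₃ ∩
      connEvent ends a₂ o ∩ (connEvent ends a₁ a₂)ᶜ) (fun _ h => ⟨h.1.1.2, h.2⟩),
    prob_a2_edge_of_subset_AQ p he (Y := connEvent ends a₁ a₃ ∩ connEvent ends a₂ o ∩
      (connEvent ends a₁ a₂)ᶜ) (fun _ h => ⟨h.1.1, h.2⟩),
    prob_a2_edge_of_subset_AQ p he (Y := connEvent ends a₁ b ∩ connEvent ends a₁ a₃ ∩
      (connEvent ends a₁ a₂)ᶜ) (fun _ h => ⟨h.1.2, h.2⟩),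
    prob_a2_edge_of_subset_AQ p he (Y := connEvent ends a₁ a₃ ∩ (connEvent ends a₁ a₂)ᶜ)
      (fun _ h => h),
    prob_eq_pin p (connEvent ends a₁ a₂)ᶜ e₂,
    prob_eq_pin p (connEvent ends a₁ b ∩ (connEvent ends a₁ a₂)ᶜ) e₂]
  ring

end TIIdentity

section TISigns
variable {V : Type*} {E : Type*} [Fintype E] [DecidableEq E] [Fintype V] [DecidableEq V]
  {R : Type*} [Field R] [LinearOrder R] [IsStrictOrderedRing R]
variable {ends : E → Sym2 V} {a₁ a₂ a₃ : V} {e₂ : E}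

omit [Fintype V] [DecidableEq V] in
/-- **The `(i)`-form at the forced-open Q-pair dominates the sum of the forms at the PD pair and at
the T-pair**, for every `b ∈ C₁`-pair with `y₁ R₂ − y₀ P₁ ≥ 0`. -/
theorem lamTI_c1_ge (p : E → R) (hp : IsProbVec p) (he : ends e₂ = s(a₂, a₃)) (o b : V)
    (y₀ y₁ : R)
    (hB : 0 ≤ y₁ * prob (Function.update p e₂ 0) (connEvent ends a₁ b ∩ connEvent ends a₁ a₃ ∩
        (connEvent ends a₁ a₂)ᶜ) -
      y₀ * prob (Function.update p e₂ 0) (connEvent ends a₁ a₃ ∩ (connEvent ends a₁ a₂)ᶜ)) :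
    (-(Dpd (Function.update p e₂ 0) ends a₁ a₂ a₃ *
        (y₁ * prob (Function.update p e₂ 0) (connEvent ends a₁ b ∩ connEvent ends a₁ a₃ ∩
            connEvent ends a₂ o ∩ (connEvent ends a₁ a₂)ᶜ) -
          y₀ * prob (Function.update p e₂ 0) (connEvent ends a₁ a₃ ∩ connEvent ends a₂ o ∩
            (connEvent ends a₁ a₂)ᶜ))) +
        Dpdo (Function.update p e₂ 0) ends o a₁ a₂ a₃ *
        (y₁ * prob (Function.update p e₂ 0) (connEvent ends a₁ b ∩ connEvent ends a₁ a₃ ∩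
            (connEvent ends a₁ a₂)ᶜ) -
          y₀ * prob (Function.update p e₂ 0) (connEvent ends a₁ a₃ ∩ (connEvent ends a₁ a₂)ᶜ))) +
      (-(Dt (Function.update p e₂ 0) ends a₁ a₂ a₃ *
        (y₁ * prob (Function.update p e₂ 0) (connEvent ends a₁ b ∩ connEvent ends a₁ a₃ ∩
            connEvent ends a₂ o ∩ (connEvent ends a₁ a₂)ᶜ) -
          y₀ * prob (Function.update p e₂ 0) (connEvent ends a₁ a₃ ∩ connEvent ends a₂ o ∩
            (connEvent ends a₁ a₂)ᶜ))) +
        Dto (Function.update p e₂ 0) ends o a₁ a₂ a₃ *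
        (y₁ * prob (Function.update p e₂ 0) (connEvent ends a₁ b ∩ connEvent ends a₁ a₃ ∩
            (connEvent ends a₁ a₂)ᶜ) -
          y₀ * prob (Function.update p e₂ 0) (connEvent ends a₁ a₃ ∩ (connEvent ends a₁ a₂)ᶜ))) ≤
    -(prob (Function.update p e₂ 1) (connEvent ends a₁ a₂)ᶜ *
        (y₁ * prob (Function.update p e₂ 0) (connEvent ends a₁ b ∩ connEvent ends a₁ a₃ ∩
            connEvent ends a₂ o ∩ (connEvent ends a₁ a₂)ᶜ) -
          y₀ * prob (Function.update p e₂ 0) (connEvent ends a₁ a₃ ∩ connEvent ends a₂ o ∩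
            (connEvent ends a₁ a₂)ᶜ))) +
        Dqo (Function.update p e₂ 1) ends o a₁ a₂ *
        (y₁ * prob (Function.update p e₂ 0) (connEvent ends a₁ b ∩ connEvent ends a₁ a₃ ∩
            (connEvent ends a₁ a₂)ᶜ) -
          y₀ * prob (Function.update p e₂ 0) (connEvent ends a₁ a₃ ∩ (connEvent ends a₁ a₂)ᶜ)) := by
  have hX := prob_Q_update_one_eq_Dpd_add (a₁ := a₁) p he
  have hU := Dqo_update_one_ge (a₁ := a₁) p hp he o
  have hDt : Dt (Function.update p e₂ 0) ends a₁ a₂ a₃ =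
      prob (Function.update p e₂ 0) (connEvent ends a₂ a₃ ∩ (connEvent ends a₁ a₂)ᶜ) := rfl
  rw [← hDt] at hX
  rw [hX]
  have hprod := mul_le_mul_of_nonneg_right hU hB
  linarith

/-- **The T-pair coefficient `Λᴵ(c_T⁰, y¹)` is nonnegative** when `(i-T)` holds for `G − e₂`. -/
theorem lamTI_c0_y1_nonneg (p : E → R) (hp : IsProbVec p) (he : ends e₂ = s(a₂, a₃)) (o b : V)
    (hT : ZSplitIT (Function.update p e₂ 0) ends o a₁ a₂ a₃ b) :
    0 ≤ -(Dt (Function.update p e₂ 0) ends a₁ a₂ a₃ *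
        (prob (Function.update p e₂ 1) (connEvent ends a₁ a₂)ᶜ *
          prob (Function.update p e₂ 0) (connEvent ends a₁ b ∩ connEvent ends a₁ a₃ ∩
            connEvent ends a₂ o ∩ (connEvent ends a₁ a₂)ᶜ) -
        prob (Function.update p e₂ 1) (connEvent ends a₁ b ∩ (connEvent ends a₁ a₂)ᶜ) *
          prob (Function.update p e₂ 0) (connEvent ends a₁ a₃ ∩ connEvent ends a₂ o ∩
            (connEvent ends a₁ a₂)ᶜ))) +
      Dto (Function.update p e₂ 0) ends o a₁ a₂ a₃ *
        (prob (Function.update p e₂ 1) (connEvent ends a₁ a₂)ᶜ *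
          prob (Function.update p e₂ 0) (connEvent ends a₁ b ∩ connEvent ends a₁ a₃ ∩
            (connEvent ends a₁ a₂)ᶜ) -
        prob (Function.update p e₂ 1) (connEvent ends a₁ b ∩ (connEvent ends a₁ a₂)ᶜ) *
          prob (Function.update p e₂ 0) (connEvent ends a₁ a₃ ∩ (connEvent ends a₁ a₂)ᶜ)) := by
  unfold ZSplitIT at hT
  rw [iExprT_eq] at hT
  set p₀ := Function.update p e₂ 0 with hp₀
  set p₁ := Function.update p e₂ 1 with hp₁
  have hp0 : IsProbVec p₀ := hp.update e₂ le_rfl zero_le_one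
  have hp1 : IsProbVec p₁ := hp.update e₂ zero_le_one le_rfl
  have hsign := a2_b1Threshold_nonpos (a₁ := a₁) p hp he b
  have hodds := odds_t (ends := ends) (a₁ := a₁) (a₂ := a₂) (a₃ := a₃) p₀ hp0 o
  have hX1 : 0 ≤ prob p₁ (connEvent ends a₁ a₂)ᶜ := prob_nonneg hp1 _
  have hX0 : 0 ≤ prob p₀ (connEvent ends a₁ a₂)ᶜ := prob_nonneg hp0 _
  set T := -(Dt p₀ ends a₁ a₂ a₃ *
        (prob p₁ (connEvent ends a₁ a₂)ᶜ *
          prob p₀ (connEvent ends a₁ b ∩ connEvent ends a₁ a₃ ∩ connEvent ends a₂ o ∩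
            (connEvent ends a₁ a₂)ᶜ) -
        prob p₁ (connEvent ends a₁ b ∩ (connEvent ends a₁ a₂)ᶜ) *
          prob p₀ (connEvent ends a₁ a₃ ∩ connEvent ends a₂ o ∩ (connEvent ends a₁ a₂)ᶜ))) +
      Dto p₀ ends o a₁ a₂ a₃ *
        (prob p₁ (connEvent ends a₁ a₂)ᶜ *
          prob p₀ (connEvent ends a₁ b ∩ connEvent ends a₁ a₃ ∩ (connEvent ends a₁ a₂)ᶜ) -
        prob p₁ (connEvent ends a₁ b ∩ (connEvent ends a₁ a₂)ᶜ) *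
          prob p₀ (connEvent ends a₁ a₃ ∩ (connEvent ends a₁ a₂)ᶜ)) with hTdef
  -- `X₀ · T = X₁ · (i-T)(p₀) + (X₀ R₁ − X₁ R₀)(Dt₀ P₃ − Dto₀ P₁)`
  have key : prob p₀ (connEvent ends a₁ a₂)ᶜ * T =
      prob p₁ (connEvent ends a₁ a₂)ᶜ *
        (-(Dt p₀ ends a₁ a₂ a₃ *
          (prob p₀ (connEvent ends a₁ a₂)ᶜ *
            prob p₀ (connEvent ends a₁ b ∩ connEvent ends a₁ a₃ ∩ connEvent ends a₂ o ∩
              (connEvent ends a₁ a₂)ᶜ) -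
          prob p₀ (connEvent ends a₁ b ∩ (connEvent ends a₁ a₂)ᶜ) *
            prob p₀ (connEvent ends a₁ a₃ ∩ connEvent ends a₂ o ∩ (connEvent ends a₁ a₂)ᶜ))) +
        Dto p₀ ends o a₁ a₂ a₃ *
          (prob p₀ (connEvent ends a₁ a₂)ᶜ *
            prob p₀ (connEvent ends a₁ b ∩ connEvent ends a₁ a₃ ∩ (connEvent ends a₁ a₂)ᶜ) -
          prob p₀ (connEvent ends a₁ b ∩ (connEvent ends a₁ a₂)ᶜ) *
            prob p₀ (connEvent ends a₁ a₃ ∩ (connEvent ends a₁ a₂)ᶜ))) +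
      (prob p₀ (connEvent ends a₁ a₂)ᶜ * prob p₁ (connEvent ends a₁ b ∩ (connEvent ends a₁ a₂)ᶜ) -
        prob p₁ (connEvent ends a₁ a₂)ᶜ * prob p₀ (connEvent ends a₁ b ∩ (connEvent ends a₁ a₂)ᶜ)) *
      (Dt p₀ ends a₁ a₂ a₃ *
          prob p₀ (connEvent ends a₁ a₃ ∩ connEvent ends a₂ o ∩ (connEvent ends a₁ a₂)ᶜ) -
        Dto p₀ ends o a₁ a₂ a₃ * prob p₀ (connEvent ends a₁ a₃ ∩ (connEvent ends a₁ a₂)ᶜ)) := by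
    rw [hTdef]; ring
  rcases eq_or_lt_of_le hX0 with hX0' | hX0'
  · have hz : ∀ Y : Set (Config E), Y ⊆ (connEvent ends a₁ a₂)ᶜ → prob p₀ Y = 0 := fun Y hY =>
      le_antisymm (by rw [hX0']; exact prob_mono hp0 hY) (prob_nonneg hp0 Y)
    have z4 : prob p₀ (connEvent ends a₁ b ∩ connEvent ends a₁ a₃ ∩ connEvent ends a₂ o ∩
        (connEvent ends a₁ a₂)ᶜ) = 0 := hz _ (fun _ h => h.2)
    have z3 : prob p₀ (connEvent ends a₁ a₃ ∩ connEvent ends a₂ o ∩ (connEvent ends a₁ a₂)ᶜ) = 0 :=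
      hz _ (fun _ h => h.2)
    have z2 : prob p₀ (connEvent ends a₁ b ∩ connEvent ends a₁ a₃ ∩ (connEvent ends a₁ a₂)ᶜ) = 0 :=
      hz _ (fun _ h => h.2)
    have z1 : prob p₀ (connEvent ends a₁ a₃ ∩ (connEvent ends a₁ a₂)ᶜ) = 0 := hz _ (fun _ h => h.2)
    rw [hTdef, z4, z3, z2, z1]
    simp
  · have hodds' : Dt p₀ ends a₁ a₂ a₃ *
          prob p₀ (connEvent ends a₁ a₃ ∩ connEvent ends a₂ o ∩ (connEvent ends a₁ a₂)ᶜ) -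
        Dto p₀ ends o a₁ a₂ a₃ * prob p₀ (connEvent ends a₁ a₃ ∩ (connEvent ends a₁ a₂)ᶜ) ≤ 0 := by
      linarith [hodds]
    have hprod := mul_nonneg_of_nonpos_of_nonpos hsign hodds'
    have hrhs := add_nonneg (mul_nonneg hX1 hT) hprod
    rw [← key] at hrhs
    exact nonneg_of_mul_nonneg_right hrhs hX0'

/-- **`(i-Q)` lifts along an `a₂a₃`-edge, unconditionally, given the three `(i)`-side forms of
`G − e₂`.** -/
theorem zSplitIQ_of_a2_edge_T (p : E → R) (hp : IsProbVec p) (he : ends e₂ = s(a₂, a₃)) (o b : V)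
    (hI : ZSplitI (Function.update p e₂ 0) ends o a₁ a₂ a₃ b)
    (hQ : ZSplitIQ (Function.update p e₂ 0) ends o a₁ a₂ a₃ b)
    (hT : ZSplitIT (Function.update p e₂ 0) ends o a₁ a₂ a₃ b) :
    ZSplitIQ p ends o a₁ a₂ a₃ b := by
  unfold ZSplitIQ
  rw [iExprQ_a2_edge p he o b]
  have hr0 : 0 ≤ p e₂ := hp.nonneg e₂
  have hr1 : 0 ≤ 1 - p e₂ := by linarith [hp.le_one e₂]
  have hp0 : IsProbVec (Function.update p e₂ 0) := hp.update e₂ le_rfl zero_le_one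
  have c00 : 0 ≤ iExprT (Function.update p e₂ 0) ends o a₁ a₂ a₃ b
      (Dqo (Function.update p e₂ 0) ends o a₁ a₂) (prob (Function.update p e₂ 0) (connEvent ends a₁ a₂)ᶜ) := hQ
  have c01 := lamQI_c0_y1_nonneg p hp he o b hQ
  have hIe := hI
  unfold ZSplitI at hIe
  rw [iExpr_eq_iExprT, iExprT_eq] at hIe
  have hTe := hT
  unfold ZSplitIT at hTe
  rw [iExprT_eq] at hTe
  have c10 := le_trans (add_nonneg hIe hTe) (lamTI_c1_ge p hp he o b _ _
    (bhk13_cleared (ends := ends) (a₁ := a₁) (a₂ := a₂) (a₃ := a₃) _ hp0 b))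
  have c11 := le_trans (add_nonneg (a2MixI_nonneg p hp he o b hI) (lamTI_c0_y1_nonneg p hp he o b hT))
    (lamTI_c1_ge p hp he o b _ _ (bhk13_forced_open p hp he b))
  have hmid := add_nonneg c01 c10
  exact mul_nonneg hr1 (add_nonneg (add_nonneg (mul_nonneg (pow_nonneg hr1 2) c00)
    (mul_nonneg (mul_nonneg hr0 hr1) hmid)) (mul_nonneg (pow_nonneg hr0 2) c11))

/-- **`(i-T)` lifts along an `a₂a₃`-edge**: `(i)(G − e₂) ∧ (i-T)(G − e₂) ⟹ (i-T)(G)`. -/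
theorem zSplitIT_of_a2_edge (p : E → R) (hp : IsProbVec p) (he : ends e₂ = s(a₂, a₃)) (o b : V)
    (hI : ZSplitI (Function.update p e₂ 0) ends o a₁ a₂ a₃ b)
    (hT : ZSplitIT (Function.update p e₂ 0) ends o a₁ a₂ a₃ b) :
    ZSplitIT p ends o a₁ a₂ a₃ b := by
  unfold ZSplitIT
  rw [iExprT_a2_edge p he o b]
  have hr0 : 0 ≤ p e₂ := hp.nonneg e₂
  have hr1 : 0 ≤ 1 - p e₂ := by linarith [hp.le_one e₂]
  have hp0 : IsProbVec (Function.update p e₂ 0) := hp.update e₂ le_rfl zero_le_one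
  have c00 : 0 ≤ iExprT (Function.update p e₂ 0) ends o a₁ a₂ a₃ b
      (Dto (Function.update p e₂ 0) ends o a₁ a₂ a₃) (Dt (Function.update p e₂ 0) ends a₁ a₂ a₃) := hT
  have c01 := lamTI_c0_y1_nonneg p hp he o b hT
  have hIe := hI
  unfold ZSplitI at hIe
  rw [iExpr_eq_iExprT, iExprT_eq] at hIe
  have hTe := hT
  unfold ZSplitIT at hTe
  rw [iExprT_eq] at hTe
  have c10 := le_trans (add_nonneg hIe hTe) (lamTI_c1_ge p hp he o b _ _
    (bhk13_cleared (ends := ends) (a₁ := a₁) (a₂ := a₂) (a₃ := a₃) _ hp0 b))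
  have c11 := le_trans (add_nonneg (a2MixI_nonneg p hp he o b hI) c01)
    (lamTI_c1_ge p hp he o b _ _ (bhk13_forced_open p hp he b))
  have hmid := add_nonneg c01 c10
  exact mul_nonneg hr1 (add_nonneg (add_nonneg (mul_nonneg (pow_nonneg hr1 2) c00)
    (mul_nonneg (mul_nonneg hr0 hr1) hmid)) (mul_nonneg (pow_nonneg hr0 2) c11))

/-- **THE SIX FORMS TRANSFER ALONG AN `a₂a₃`-EDGE** — `(ii), (ii-Q), (ii-T), (i), (i-Q), (i-T)` of
`G − e₂` give the six forms of `G`, with no threshold hypothesis. -/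
theorem sixForms_of_a2_edge (p : E → R) (hp : IsProbVec p) (he : ends e₂ = s(a₂, a₃)) (o b : V)
    (h : ZSplitII (Function.update p e₂ 0) ends o a₁ a₂ a₃ b ∧
      ZSplitIIQ (Function.update p e₂ 0) ends o a₁ a₂ a₃ b ∧
      ZSplitIIT (Function.update p e₂ 0) ends o a₁ a₂ a₃ b ∧
      ZSplitI (Function.update p e₂ 0) ends o a₁ a₂ a₃ b ∧
      ZSplitIQ (Function.update p e₂ 0) ends o a₁ a₂ a₃ b ∧
      ZSplitIT (Function.update p e₂ 0) ends o a₁ a₂ a₃ b) :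
    ZSplitII p ends o a₁ a₂ a₃ b ∧ ZSplitIIQ p ends o a₁ a₂ a₃ b ∧ ZSplitIIT p ends o a₁ a₂ a₃ b ∧
      ZSplitI p ends o a₁ a₂ a₃ b ∧ ZSplitIQ p ends o a₁ a₂ a₃ b ∧ ZSplitIT p ends o a₁ a₂ a₃ b := by
  obtain ⟨hII, hIIQ, hIIT, hI, hIQ, hIT⟩ := h
  exact ⟨zSplitII_of_a2_edge p hp he o b hII, zSplitIIQ_of_a2_edge_T p hp he o b hII hIIQ hIIT,
    zSplitIIT_of_a2_edge p hp he o b hII hIIT, zSplitI_of_a2_edge p hp he o b hI,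
    zSplitIQ_of_a2_edge_T p hp he o b hI hIQ hIT, zSplitIT_of_a2_edge p hp he o b hI hIT⟩

/-- **The six forms are free of the `a₂`-edges at the statement vertex**: they hold for `p` as
soon as they hold for every admissible weight vector with every `a₂a₃`-edge null. -/
theorem sixForms_of_a2Free (p : E → R) (hp : IsProbVec p) (o b : V)
    (base : ∀ p' : E → R, IsProbVec p' → (∀ e, ends e = s(a₂, a₃) → p' e = 0) →
      ZSplitII p' ends o a₁ a₂ a₃ b ∧ ZSplitIIQ p' ends o a₁ a₂ a₃ b ∧ ZSplitIIT p' ends o a₁ a₂ a₃ b ∧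
        ZSplitI p' ends o a₁ a₂ a₃ b ∧ ZSplitIQ p' ends o a₁ a₂ a₃ b ∧ ZSplitIT p' ends o a₁ a₂ a₃ b) :
    ZSplitII p ends o a₁ a₂ a₃ b ∧ ZSplitIIQ p ends o a₁ a₂ a₃ b ∧ ZSplitIIT p ends o a₁ a₂ a₃ b ∧
      ZSplitI p ends o a₁ a₂ a₃ b ∧ ZSplitIQ p ends o a₁ a₂ a₃ b ∧ ZSplitIT p ends o a₁ a₂ a₃ b := by
  generalize hn : (Finset.univ.filter fun e' => ends e' = s(a₂, a₃) ∧ p e' ≠ 0).card = n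
  induction n using Nat.strong_induction_on generalizing p with
  | _ n ih =>
    by_cases h0 : (Finset.univ.filter fun e' => ends e' = s(a₂, a₃) ∧ p e' ≠ 0) = ∅
    · refine base p hp fun e he => ?_
      by_contra hc
      have : e ∈ (Finset.univ.filter fun e' => ends e' = s(a₂, a₃) ∧ p e' ≠ 0) := by simp [he, hc]
      rw [h0] at this
      exact absurd this (Finset.notMem_empty e)
    · obtain ⟨e, he⟩ := Finset.nonempty_iff_ne_empty.mpr h0
      have he' : ends e = s(a₂, a₃) := by
        have := he
        simp only [Finset.mem_filter, Finset.mem_univ, true_and] at this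
        exact this.1
      have hlt : ((Finset.univ.filter fun e' => ends e' = s(a₂, a₃) ∧ p e' ≠ 0).erase e).card < n := by
        rw [← hn]; exact Finset.card_erase_lt_of_mem he
      have hp0 : IsProbVec (Function.update p e 0) := hp.update e le_rfl zero_le_one
      have hrec := ih _ hlt (Function.update p e 0) hp0 (by rw [filter_liveA2_update])
      exact sixForms_of_a2_edge p hp he' o b hrec

end TISigns

end CaseOne

end Summit.Ventures.PercRepro2
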